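import Summits.AtomisticToContinuum.Crystallization.Theorems.ThreeConeCertificateSlackRigidityThinning
import Literature.MathematicalPhysics.StatisticalMechanics.LennardJonesClusters
import HarnessLib

/-!
# Line `ekeland-surgery-parity` (crux `SlackRigidity`, stmt-AtomisticToContinuum-11960): quasi-ground-states are `1/3`-separated

Stub `stub_qgsSeparation` (E2) of the line skeleton.  A `λ`-quasi-ground-state is an injective
Lennard-Jones configuration `x` of `N` points of `ℝ³` such that no injective `y` has
`𝓔(y) < 𝓔(x) − λ · #{i : y i ≠ x i}`.  For every `λ ≤ 10⁴` such an `x` is uniformly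
`1/3`-separated — the quasi-minimal analogue of the tree's `LennardJonesMinimalDistance_holds`
(Xue 1997 / Blanc–Lewin 2015 §2.2 for ground states).

Proof.  If two points were closer than `1/3`, a particle `i₀` of a closest pair has site energy
`≥ 729·229/12 > 10⁴` (`CLayerWitnessThinning.exists_le_siteEnergy_of_dist_lt`).  Relocate it to
the far point `y = c • e₀`, `c = 1 + ∑ₖ ‖x k‖`: all new distances are `≥ 1`, where `V_LJ ≤ 0`
(`lennardJones_nonpos`), so by the bookkeeping identities `sum_siteEnergy_update_sub` and
`two_mul_interactionEnergy` the energy drops by at least the site energy of `i₀`, i.e. by more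
than `10⁴ ≥ λ`, while the move has Hamming distance exactly `1` — contradicting
quasi-minimality.  All `[folklore]`.
-/

noncomputable section

namespace Summit.AtomisticToContinuum.Crystallization.Theorems.EkelandQgsSeparation

open scoped BigOperators
open Literature.MathematicalPhysics.StatisticalMechanics
open Summit.AtomisticToContinuum.Crystallization.Theorems.SlackRigidityNegative (E3)

/-- **Stub E2 — quasi-ground-states are uniformly separated** (`δ = 1/3`, every `λ ≤ 10⁴`).
If an injective Lennard-Jones configuration `x` in `ℝ³` is `λ`-quasi-minimal in the Hamming
metric (no injective `y` has `𝓔(y) < 𝓔(x) − λ · #{i : y i ≠ x i}`) with `λ ≤ 10⁴`, then all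
mutual distances are `≥ 1/3`: otherwise a particle `i₀` of a closest pair has site energy
`≥ 729·229/12 > 10⁴` (`CLayerWitnessThinning.exists_le_siteEnergy_of_dist_lt`), and relocating
it to a far point (all new distances `≥ 1`, where `V_LJ ≤ 0`) is a Hamming-distance-`1` move
lowering the energy by more than `λ`. [folklore] -/
theorem stub_qgsSeparation :
    ∀ (N : ℕ) (lam : ℝ), lam ≤ 10 ^ 4 → ∀ x : Fin N → E3, Function.Injective x →
      (∀ y : Fin N → E3, Function.Injective y →
        interactionEnergy lennardJones x -
            lam * ((Finset.univ.filter fun i => y i ≠ x i).card : ℝ) ≤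
          interactionEnergy lennardJones y) →
      ∀ i j : Fin N, i ≠ j → (1 / 3 : ℝ) ≤ dist (x i) (x j) := by
  intro N lam hlam x hx hq i j hij
  by_contra hlt
  rw [not_le] at hlt
  -- a particle `i₀` of a closest pair has site energy `≥ 729·229/12`
  obtain ⟨i₀, hi₀⟩ := CLayerWitnessThinning.exists_le_siteEnergy_of_dist_lt hx hij hlt
  -- a far point `y`
  set c : ℝ := 1 + ∑ k, ‖x k‖ with hc
  set y : E3 := EuclideanSpace.single (0 : Fin 3) c with hy_def
  have hc0 : 0 ≤ c := add_nonneg zero_le_one (Finset.sum_nonneg fun k _ => norm_nonneg (x k))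
  have hyn : ‖y‖ = c := by simp [hy_def, abs_of_nonneg hc0]
  have hy : ∀ k, 1 ≤ dist y (x k) := fun k => by
    have h1 : ‖x k‖ ≤ ∑ l, ‖x l‖ :=
      Finset.single_le_sum (f := fun l => ‖x l‖) (fun l _ => norm_nonneg _) (Finset.mem_univ k)
    have h2 : ‖y‖ - ‖x k‖ ≤ dist y (x k) := by rw [dist_eq_norm]; exact norm_sub_norm_le y (x k)
    linarith
  have hy' : ∀ k, y ≠ x k := fun k h => by
    have := hy k
    rw [h, dist_self] at this
    exact absurd this (by norm_num)
  -- the modified configuration consists of distinct points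
  have hinj : Function.Injective (Function.update x i₀ y) := by
    intro a b hab
    by_cases ha : a = i₀ <;> by_cases hb : b = i₀
    · exact ha.trans hb.symm
    · subst ha
      rw [Function.update_self, Function.update_of_ne hb] at hab
      exact absurd hab (hy' b)
    · subst hb
      rw [Function.update_self, Function.update_of_ne ha] at hab
      exact absurd hab.symm (hy' a)
    · rw [Function.update_of_ne ha, Function.update_of_ne hb] at hab
      exact hx hab
  -- the move has Hamming distance exactly `1`
  have hcard : ((Finset.univ.filter fun i => Function.update x i₀ y i ≠ x i).card : ℝ) = 1 := by
    have hset : (Finset.univ.filter fun i => Function.update x i₀ y i ≠ x i) = {i₀} := by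
      ext k
      by_cases hk : k = i₀
      · subst hk
        simp [hy' k]
      · simp [hk]
    rw [hset, Finset.card_singleton, Nat.cast_one]
  -- quasi-minimality applied to the move
  have h := hq (Function.update x i₀ y) hinj
  rw [hcard, mul_one] at h
  -- energy bookkeeping
  have hdiff := sum_siteEnergy_update_sub lennardJones x i₀ y
  have hneg : ∑ k ∈ Finset.univ.erase i₀, lennardJones (dist y (x k)) ≤ 0 :=
    Finset.sum_nonpos fun k _ => lennardJones_nonpos (hy k)
  have h2 := two_mul_interactionEnergy lennardJones x
  have h2' := two_mul_interactionEnergy lennardJones (Function.update x i₀ y)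
  have hK : (10 : ℝ) ^ 4 < 729 * 229 / 12 := by norm_num
  linarith

end Summit.AtomisticToContinuum.Crystallization.Theorems.EkelandQgsSeparation

end
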